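import Summits.BirchSwinnertonDyer.BirchSwinnertonDyer.Theorems.AlignedTransportAtTwoMainConjectureOfRankZeroBSDAtTwoRoadSecondFixedPoint
import Literature.NumberTheory.EllipticCurves.PAdicLFunctionZeroAtMinusTwoProofs
import Literature.NumberTheory.EllipticCurves.PAdicLFunctionIntegralityAtTwoAutoProofs
import Literature.NumberTheory.EllipticCurves.PAdicLFunctionProofs
import Literature.NumberTheory.EllipticCurves.KatoRankBound
import Literature.NumberTheory.EllipticCurves.SelmerCorankHolds
import Literature.NumberTheory.EllipticCurves.IwasawaLeadingTermProofs
import Summits.BirchSwinnertonDyer.BirchSwinnertonDyer.Theorems.LambdaTransportDoorAtTwoMainConjecture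
import HarnessLib

/-!
# Cell bsd-rank2 (p2 GEN 63): the VALUE-AT-`−2` DOOR — what `2`-adic BSD gives at rank `≥ 2` from FOUR modular symbols
# `corank_{ℤ₂} Sel_{2^∞}(E/ℚ) ≤ ord_{T=0} L₂(E,T) ≤ v₂(L₂(E, T=−2)) = v₂(S₈(f))`, `S₈(f) = ∑_{a mod 8} χ₈(a)·[a/8]⁺_f`,
# and the EXACT door `w(E) = +1 ∧ rank ≥ 2 ∧ v₂(S₈) ≤ 3 ⟹ ord_{T=0} L₂ = corank Sel_{2^∞} = rank = 2 ∧ Ш(E)[2^∞] finite`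

Support file for the open crux `DepletedLambdaLawAtTwoModNSF` of `EisensteinDepletionAtTwo` (stmt-27021) — the
rank-`≥ 2` Selmer-versus-analytic comparison at `p = 2` which that route, and every `λ`-transport door of this cell
(`LambdaTransportDoorAtTwo*`), needs at the END of the `Λ`-algebra; kernel theorems only, no new definitions,
no `sorry`. Instrument for barrier B1 (no S0 claim: the door decides the `2`-ADIC order of vanishing, not `L''(E,1)`).

## The mechanism (MTT §I.14 at the conductor-`8` character + `|−2|₂ = ½` + Kato 18.4 + Greenberg's sign)

Let `E/ℚ` be globally minimal (`W`), good ORDINARY at `2`, `f` its newform, `α = unitRoot W 2 ∈ ℤ₂^×`,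
`L₂(E,T) = padicLFunction f α ∈ ℚ₂⟦T⟧` and `L₀ ∈ ℤ₂⟦T⟧` its integral lift (INT2-AUTO,
`exists_iwasawaToPowerSeries_eq_padicLFunction_two_auto`: no hypothesis on `E[2]`). The character `χ₈ = (2/·)` of
conductor `8` is the order-`2` character of `Γ = 1 + 4ℤ₂` with `χ₈(γ) = χ₈(5) = −1`, i.e. the point `T = −2` of the open
unit disc, and Mazur–Tate–Teitelbaum interpolation there reads (tree theorem `hasSum_coeff_padicLFunction_two_neg_two`)
`L₂(E, −2) = α⁻³ · S₈(f)`, `S₈(f) := ∑_{a mod 8} χ₈(a) [a/8]⁺_f ∈ ℚ` (`= τ(χ₈) L(E, χ₈, 1)/Ω⁺_f = √8·L(E^{(2)},1)/Ω⁺_f`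
by Birch's formula). Hence, with `m := ord_{T=0} L₀`:

* §1–§2 (`Λ`-algebra + MTT): `T^m ∣ L₀ ⟹ L₀(−2) ∈ (−2)^m ℤ₂ ⟹ ‖α³ L₀(−2)‖ ≤ 2^{−m}`, and `α³·L₀(−2) = S₈(f)` in `ℚ₂`
  (`coe_unitRoot_pow_mul_evalAt_negTwo`); so `S₈(f) ∈ ℤ₂ ∩ ℚ` and, if `S₈(f) ≠ 0`, **`ord_{T=0} L₂(E,T) ≤ v₂(S₈(f))`**
  (`order_padicLFunction_le_padicValRat`). (`|−2|₂ = ½`: the layer-one point of the `2`-adic open disc is the unique point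
  `ζ − 1`, `ζ` a `p`-power root of unity, of valuation `≥ 1` — at odd `p` or deeper layers `v(ζ−1) < 1` and the value bounds
  nothing integral; this is why the door lives at `(p, n) = (2, 1)` only.)
* §3 (+ Kato): with Kato's divisibility at `p = 2` AS PRINTED (`kato_selmerCorank_le_order_padicLFunction_allPrimes`, Thm 18.4,
  carried as the hypothesis `hK`): **`corank_{ℤ₂} Sel_{2^∞}(E/ℚ) = rank E(ℚ) + corank_{ℤ₂} Ш(E/ℚ)[2^∞] ≤ v₂(S₈(f))`** for EVERY
  `E` good ordinary at `2` with `S₈(f) ≠ 0` — the Literature-grade rank-`≥ 2` inequality of the seat, in closed form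
  (`selmerCorank_le_padicValRat`, `mordellWeilRank_add_shaCorank_le_padicValRat`).
* §4 (+ Greenberg's sign `(−1)^{ord_{T=0}} = w(E)`, tree theorem `neg_one_pow_orderAtZero_eq_rootNumber`): if `w(E) = +1`,
  `S₈(f) ≠ 0`, `v₂(S₈(f)) ≤ 3` and `corank Sel_{2^∞} ≥ 2` (e.g. `rank E(ℚ) ≥ 2` by exhibited points), then
  `2 ≤ corank ≤ ord_{T=0} ≤ 3` and `ord_{T=0}` is even, so **`ord_{T=0} L₂(E,T) = corank_{ℤ₂} Sel_{2^∞}(E/ℚ) = 2`**; in rank form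
  **`rank E(ℚ) = 2`, `corank Ш(E/ℚ)[2^∞] = 0` (so `Ш(E/ℚ)[2^∞]` is finite) and `ord_{T=0} L₂(E,T) = 2 = rank`** — the `2`-adic
  BSD rank statement for `E`, EXACTLY, from four modular symbols (`door`, `door_rank`, `finite_sha_two_of_door`).

No `μ = 0`, no main conjecture, no Euler-characteristic formula, no torsion or Tamagawa credit enters: value and order
comparisons are immune to `2`-power fudge factors (GEN 62 showed the control-cokernel form of the door never fires without an
exact Euler characteristic, BN-63.1). Where it applies: `S₈(f) ≠ 0` needs `w(E^{(2)}) = +1`, and `w(E^{(2)}) = χ₈(N_E)·w(E)`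
(the tree's `(−1)^{e mod 2} = χ₈(N_W)`, `exists_integral_functional_equation`), so together with `w(E) = +1` the door is
available exactly on conductors `N_E ≡ ±1 (mod 8)`.

## Evidence (kit, PARI modular symbols; instrument N3, not a claim)

GEN 62 toy table (job j340694, 36 421 curves `N ≤ 12000`): of the 21 rank-`2` curves good ordinary at `2` in the box, the 10
with `N ≡ ±1 (mod 8)` ALL have `v₂(S₈) ∈ {2, 3}` (door fires: `ord_{T=0} L₂ = 2 = rank`, `Ш[2^∞]` finite), the 11 with
`N ≡ ±3 (mod 8)` have `S₈ = 0` (`E^{(2)}` of odd analytic rank), as the sign law predicts. GEN 63 (job j340844,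
`classdoor.gp`): the same statistic on quadratic-twist CLASSES `E₀^{(M)}`, `M ≡ 1 (mod 4)`, where the print side
(Zhai 2016; Cai–Li–Zhai 2020; Adachi–Nomoto–Shii 2026) gives `v₂(L(E₀^{(2M)},1)/Ω)` exactly on Chebotarev classes of `M` — the
candidate "extra input that turns the inequality into equality on an infinite class" (memo `pub/bsd-rank2/p2/g63/GEN63.md`).

[cite: MazurTateTeitelbaum1986Invent, §I.14 Proposition (p. 20) and §I.12]
[cite: Kato2004Asterisque, Thm. 18.4 (p. 281)] [cite: GreenbergLNM1716, §5 p. 181]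
-/

set_option linter.dupNamespace false
set_option autoImplicit false

noncomputable section

open scoped MatrixGroups ModularForm

open PowerSeries CongruenceSubgroup WeierstrassCurve Literature.NumberTheory.EllipticCurves
  Literature.NumberTheory.EllipticCurves.ModularForms
  Summit.BirchSwinnertonDyer.Rank1Residual.Supersingular Summit.BirchSwinnertonDyer.Rank1Residual.F1Sign2
  Summit.BirchSwinnertonDyer.BirchSwinnertonDyer.Theorems.AlignedTransportAtTwoTwoFixedPoints
  Summit.BirchSwinnertonDyer.BirchSwinnertonDyer.Theorems.AlignedTransportAtTwoRoadSecondFixedPoint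
  Summit.BirchSwinnertonDyer.BirchSwinnertonDyer.Theorems

namespace Summit.BirchSwinnertonDyer.BirchSwinnertonDyer.Theorems.LambdaTransportDoorAtTwoValueAtMinusTwo

/-! ## §1 `Λ`-algebra at the layer-one point `T = −2`: `T^m ∣ g ⟹ g(−2) ∈ (−2)^m ℤ₂`, `‖g(−2)‖ ≤ 2^{−m}` -/

/-- `‖−2‖ = ½` in `ℤ₂`: the conductor-`8` point of the open unit disc has valuation exactly `1`. [folklore] -/
theorem norm_neg_two_eq_inv_two : ‖(-2 : ℤ_[2])‖ = (2 : ℝ)⁻¹ := by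
  rw [norm_neg, show (2 : ℤ_[2]) = ((2 : ℕ) : ℤ_[2]) by norm_num, PadicInt.norm_p]
  norm_num

/-- `T^m ∣ g` in `ℤ₂⟦T⟧` forces `g(−2) = (−2)^m · u` for some `u ∈ ℤ₂` (evaluation at `−2` is a ring map).
[folklore] -/
theorem evalAt_negTwo_eq_of_X_pow_dvd {g : PowerSeries ℤ_[2]} {m : ℕ} (hm : (X : PowerSeries ℤ_[2]) ^ m ∣ g) :
    ∃ u : ℤ_[2], BlindLever.evalAt (-2 : ℤ_[2]) g = (-2 : ℤ_[2]) ^ m * u := by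
  obtain ⟨h, rfl⟩ := hm
  refine ⟨BlindLever.evalAt (-2 : ℤ_[2]) h, ?_⟩
  rw [BlindLever.evalAt_mul BlindLever.norm_neg_two_lt_one,
    ← BlindLever.evalAtHom_apply BlindLever.norm_neg_two_lt_one (X ^ m), map_pow,
    BlindLever.evalAtHom_apply, BlindLever.evalAt_X]

/-- **`T^m ∣ g ⟹ ‖g(−2)‖ ≤ 2^{−m}`**: the order of vanishing at `T = 0` bounds the `2`-adic valuation of the value at the
layer-one point from below. [folklore] -/
theorem norm_evalAt_negTwo_le_of_X_pow_dvd {g : PowerSeries ℤ_[2]} {m : ℕ}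
    (hm : (X : PowerSeries ℤ_[2]) ^ m ∣ g) :
    ‖BlindLever.evalAt (-2 : ℤ_[2]) g‖ ≤ (2 : ℝ)⁻¹ ^ m := by
  obtain ⟨u, hu⟩ := evalAt_negTwo_eq_of_X_pow_dvd hm
  rw [hu]
  calc ‖(-2 : ℤ_[2]) ^ m * u‖ ≤ ‖(-2 : ℤ_[2]) ^ m‖ * ‖u‖ := norm_mul_le _ _
    _ ≤ ‖(-2 : ℤ_[2])‖ ^ m * 1 :=
        mul_le_mul (norm_pow_le _ _) (PadicInt.norm_le_one _) (norm_nonneg _) (pow_nonneg (norm_nonneg _) _)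
    _ = (2 : ℝ)⁻¹ ^ m := by rw [mul_one, norm_neg_two_eq_inv_two]

/-! ## §2 MTT at `χ₈`, VALUE form: `α³ · g(−2) = c · S₈(f)` in `ℚ₂` for every integral model `g` of `c·L₂(E,T)` -/

section Value

variable {W : WeierstrassCurve ℚ} [W.IsElliptic] [W.IsGloballyMinimal]
  {N : ℕ} [NeZero N] {f : CuspForm (Gamma0 N) 2}

/-- **The value of an integral model of `L₂(E,T)` at `T = −2`.** For `E/ℚ` globally minimal (`W`), good ordinary at `2`, with
newform `f` (any level) and unit root `α`, and any `g ∈ ℤ₂⟦T⟧`, `c ∈ ℚ₂` with `ι g = c · L₂(E,T)`: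
`α³ · g(−2) = c · S₈(f)` in `ℚ₂`, `S₈(f) = ∑_{a mod 8} χ₈(a) [a/8]⁺_f ∈ ℚ` — Mazur–Tate–Teitelbaum interpolation at the
conductor-`8` character (`hasSum_coeff_padicLFunction_two_neg_two`, in `ℂ₂`) pulled back to `ℚ₂` along the injection
`ℚ₂ → ℂ₂`. [cite: MazurTateTeitelbaum1986Invent, §I.14 Proposition (p. 20)] -/
theorem coe_unitRoot_pow_mul_evalAt_negTwo (hord : IsOrdinaryAt W 2) (hf : IsNewformOf W f)
    {c : ℚ_[2]} {g : PowerSeries ℤ_[2]}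
    (hg : iwasawaToPowerSeries 2 g = C c * padicLFunction f (unitRoot W 2 : ℚ_[2])) :
    ((unitRoot W 2 ^ 3 * BlindLever.evalAt (-2 : ℤ_[2]) g : ℤ_[2]) : ℚ_[2]) =
      c * ((ratTwistedSymbolSum f (ZMod.χ₈.ringHomComp (Int.castRingHom ℚ)) : ℚ) : ℚ_[2]) := by
  have ht := BlindLever.norm_neg_two_lt_one
  have hs : HasSum (fun k : ℕ ↦ coeff k g * (-2 : ℤ_[2]) ^ k) (BlindLever.evalAt (-2 : ℤ_[2]) g) :=
    (BlindLever.summable_coeff_mul_pow ht g).hasSum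
  set φ : ℤ_[2] →+* ℂ_[2] := (algebraMap ℚ_[2] ℂ_[2]).comp (PadicInt.Coe.ringHom (p := 2)) with hφdef
  have hφc : Continuous φ := (continuous_algebraMap ℚ_[2] ℂ_[2]).comp continuous_subtype_val
  have hφapp : ∀ x : ℤ_[2], φ x = algebraMap ℚ_[2] ℂ_[2] (x : ℚ_[2]) := fun _ ↦ rfl
  have hg' : g.map (PadicInt.Coe.ringHom (p := 2)) = C c * padicLFunction f (unitRoot W 2 : ℚ_[2]) := hg
  have hcoeff : ∀ k : ℕ, ((coeff k g : ℤ_[2]) : ℚ_[2]) =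
      c * PowerSeries.coeff k (padicLFunction f (unitRoot W 2 : ℚ_[2])) := fun k ↦ by
    have := congrArg (PowerSeries.coeff k) hg'
    rwa [PowerSeries.coeff_map, PowerSeries.coeff_C_mul] at this
  have h1 : HasSum (fun k : ℕ ↦ φ (coeff k g * (-2 : ℤ_[2]) ^ k)) (φ (BlindLever.evalAt (-2 : ℤ_[2]) g)) :=
    hs.map φ hφc
  have hfun : (fun k : ℕ ↦ φ (coeff k g * (-2 : ℤ_[2]) ^ k)) = fun k ↦
      algebraMap ℚ_[2] ℂ_[2] c * (algebraMap ℚ_[2] ℂ_[2]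
        (PowerSeries.coeff k (padicLFunction f (unitRoot W 2 : ℚ_[2]))) * (-2) ^ k) := by
    funext k
    rw [map_mul, map_pow, map_neg, map_ofNat, hφapp, hcoeff k, map_mul]
    ring
  have h2 : HasSum (fun k : ℕ ↦ φ (coeff k g * (-2 : ℤ_[2]) ^ k))
      (algebraMap ℚ_[2] ℂ_[2] c * (algebraMap ℚ_[2] ℂ_[2] ((unitRoot W 2 : ℚ_[2])⁻¹ ^ 3) *
        (((ratTwistedSymbolSum f (ZMod.χ₈.ringHomComp (Int.castRingHom ℚ)) : ℚ) : ℂ_[2])))) := by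
    have h0 := (hasSum_coeff_padicLFunction_two_neg_two hord hf).mul_left (algebraMap ℚ_[2] ℂ_[2] c)
    rw [ratTwistedSymbolSum_χ₈_eq_cast f ℂ_[2]] at h0
    rwa [hfun]
  have hφs := h1.unique h2
  have hα : (unitRoot W 2 : ℚ_[2]) ≠ 0 := fun h0 ↦
    (unitRoot_spec_holds W 2 hord).2.ne_zero (Subtype.coe_injective (h0.trans PadicInt.coe_zero.symm))
  have hαC : algebraMap ℚ_[2] ℂ_[2] (unitRoot W 2 : ℚ_[2]) ≠ 0 :=
    (map_ne_zero_iff _ (algebraMap ℚ_[2] ℂ_[2]).injective).mpr hα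
  apply (algebraMap ℚ_[2] ℂ_[2]).injective
  change φ (unitRoot W 2 ^ 3 * BlindLever.evalAt (-2 : ℤ_[2]) g) = _
  rw [map_mul φ, map_pow φ, hφs, hφapp, map_mul (algebraMap ℚ_[2] ℂ_[2]), map_ratCast,
    map_pow (algebraMap ℚ_[2] ℂ_[2]), map_inv₀, inv_pow]
  generalize algebraMap ℚ_[2] ℂ_[2] (unitRoot W 2 : ℚ_[2]) = A at hαC ⊢
  rw [show A ^ 3 * (algebraMap ℚ_[2] ℂ_[2] c * ((A ^ 3)⁻¹ *
      (((ratTwistedSymbolSum f (ZMod.χ₈.ringHomComp (Int.castRingHom ℚ)) : ℚ) : ℂ_[2])))) =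
      (A ^ 3 * (A ^ 3)⁻¹) * (algebraMap ℚ_[2] ℂ_[2] c *
        (((ratTwistedSymbolSum f (ZMod.χ₈.ringHomComp (Int.castRingHom ℚ)) : ℚ) : ℂ_[2]))) by ring,
    mul_inv_cancel₀ (pow_ne_zero 3 hαC), one_mul]

/-- **`‖c · S₈(f)‖₂ ≤ 2^{−m}` whenever `T^m` divides an integral model `g` of `c·L₂(E,T)`** (§1 + the value identity:
`‖c·S₈‖ = ‖α³ g(−2)‖ ≤ ‖g(−2)‖ ≤ 2^{−m}`). [cite: MazurTateTeitelbaum1986Invent, §I.14 Proposition (p. 20)] -/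
theorem norm_mul_ratTwistedSymbolSum_le_of_X_pow_dvd (hord : IsOrdinaryAt W 2) (hf : IsNewformOf W f)
    {c : ℚ_[2]} {g : PowerSeries ℤ_[2]}
    (hg : iwasawaToPowerSeries 2 g = C c * padicLFunction f (unitRoot W 2 : ℚ_[2]))
    {m : ℕ} (hm : (X : PowerSeries ℤ_[2]) ^ m ∣ g) :
    ‖c * ((ratTwistedSymbolSum f (ZMod.χ₈.ringHomComp (Int.castRingHom ℚ)) : ℚ) : ℚ_[2])‖ ≤ (2 : ℝ)⁻¹ ^ m := by
  rw [← coe_unitRoot_pow_mul_evalAt_negTwo hord hf hg, PadicInt.padic_norm_e_of_padicInt]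
  calc ‖unitRoot W 2 ^ 3 * BlindLever.evalAt (-2 : ℤ_[2]) g‖
      ≤ ‖unitRoot W 2 ^ 3‖ * ‖BlindLever.evalAt (-2 : ℤ_[2]) g‖ := norm_mul_le _ _
    _ ≤ 1 * (2 : ℝ)⁻¹ ^ m :=
        mul_le_mul (PadicInt.norm_le_one _) (norm_evalAt_negTwo_le_of_X_pow_dvd hm) (norm_nonneg _) zero_le_one
    _ = (2 : ℝ)⁻¹ ^ m := one_mul _

/-- **`T^m ∣ L₀ ⟹ m ≤ v₂(S₈(f))`** for the integral lift `L₀` of `L₂(E,T)` itself (`c = 1`) and `S₈(f) ≠ 0`: the norm bound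
of `norm_mul_ratTwistedSymbolSum_le_of_X_pow_dvd` in valuation language (`‖q‖₂ = 2^{−v₂(q)}` for `q ∈ ℚ^×`).
[cite: MazurTateTeitelbaum1986Invent, §I.14 Proposition (p. 20)] -/
theorem natCast_le_padicValRat_of_X_pow_dvd (hord : IsOrdinaryAt W 2) (hf : IsNewformOf W f)
    {g : PowerSeries ℤ_[2]} (hg : iwasawaToPowerSeries 2 g = padicLFunction f (unitRoot W 2 : ℚ_[2]))
    (hS0 : ratTwistedSymbolSum f (ZMod.χ₈.ringHomComp (Int.castRingHom ℚ)) ≠ 0)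
    {m : ℕ} (hm : (X : PowerSeries ℤ_[2]) ^ m ∣ g) :
    (m : ℤ) ≤ padicValRat 2 (ratTwistedSymbolSum f (ZMod.χ₈.ringHomComp (Int.castRingHom ℚ))) := by
  have hg' : iwasawaToPowerSeries 2 g = C (1 : ℚ_[2]) * padicLFunction f (unitRoot W 2 : ℚ_[2]) := by
    rw [map_one, one_mul]; exact hg
  have h := norm_mul_ratTwistedSymbolSum_le_of_X_pow_dvd hord hf hg' hm
  rw [one_mul] at h
  have h2 : ‖((ratTwistedSymbolSum f (ZMod.χ₈.ringHomComp (Int.castRingHom ℚ)) : ℚ) : ℚ_[2])‖ =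
      (2 : ℝ) ^ (-padicValRat 2 (ratTwistedSymbolSum f (ZMod.χ₈.ringHomComp (Int.castRingHom ℚ)))) := by
    rw [Padic.eq_padicNorm, padicNorm.eq_zpow_of_nonzero hS0]
    push_cast
    rfl
  rw [h2, inv_pow, ← zpow_natCast, ← zpow_neg, zpow_le_zpow_iff_right₀ (by norm_num : (1 : ℝ) < 2)] at h
  omega

/-- **`S₈(f) ∈ ℤ₂`, i.e. `v₂(S₈(f)) ≥ 0`** (for `S₈(f) ≠ 0`): the case `m = 0`, from INT2-AUTO integrality of `L₂(E,T)` on the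
good-ordinary-at-`2` locus. [cite: MazurTateTeitelbaum1986Invent, §I.12] -/
theorem padicValRat_ratTwistedSymbolSum_nonneg (hord : IsOrdinaryAt W 2) (hf : IsNewformOf W f)
    (hS0 : ratTwistedSymbolSum f (ZMod.χ₈.ringHomComp (Int.castRingHom ℚ)) ≠ 0) :
    0 ≤ padicValRat 2 (ratTwistedSymbolSum f (ZMod.χ₈.ringHomComp (Int.castRingHom ℚ))) := by
  obtain ⟨L₀, hL₀⟩ := exists_iwasawaToPowerSeries_eq_padicLFunction_two_auto hord hf
  exact_mod_cast natCast_le_padicValRat_of_X_pow_dvd hord hf hL₀ hS0 (m := 0) (by rw [pow_zero]; exact one_dvd _)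

/-- The integral lift `L₀` of `L₂(E,T)` is NON-ZERO as soon as `S₈(f) ≠ 0` (its value at `−2` is `α⁻³ S₈(f) ≠ 0`).
[cite: MazurTateTeitelbaum1986Invent, §I.14 Proposition (p. 20)] -/
theorem lift_ne_zero_of_ratTwistedSymbolSum_ne_zero (hord : IsOrdinaryAt W 2) (hf : IsNewformOf W f)
    {g : PowerSeries ℤ_[2]} (hg : iwasawaToPowerSeries 2 g = padicLFunction f (unitRoot W 2 : ℚ_[2]))
    (hS0 : ratTwistedSymbolSum f (ZMod.χ₈.ringHomComp (Int.castRingHom ℚ)) ≠ 0) : g ≠ 0 := by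
  intro h0
  have hg' : iwasawaToPowerSeries 2 g = C (1 : ℚ_[2]) * padicLFunction f (unitRoot W 2 : ℚ_[2]) := by
    rw [map_one, one_mul]; exact hg
  have hv := coe_unitRoot_pow_mul_evalAt_negTwo hord hf hg'
  rw [h0, BlindLever.evalAt_zero, mul_zero, PadicInt.coe_zero, one_mul] at hv
  exact hS0 (by exact_mod_cast hv.symm)

/-- **`ord_{T=0} L₂(E,T) ≤ v₂(S₈(f))`** (in `ℕ∞`) for `E` good ordinary at `2` with `S₈(f) ≠ 0`: the order of vanishing of the
`2`-adic `L`-function at the trivial character is bounded by the `2`-adic valuation of FOUR modular symbols,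
`S₈(f) = 2([1/8]⁺_f − [3/8]⁺_f)`·(symmetrised). [cite: MazurTateTeitelbaum1986Invent, §I.14 Proposition (p. 20)] -/
theorem order_padicLFunction_le_padicValRat (hord : IsOrdinaryAt W 2) (hf : IsNewformOf W f)
    (hS0 : ratTwistedSymbolSum f (ZMod.χ₈.ringHomComp (Int.castRingHom ℚ)) ≠ 0) :
    (padicLFunction f (unitRoot W 2 : ℚ_[2])).order ≤
      ((padicValRat 2 (ratTwistedSymbolSum f (ZMod.χ₈.ringHomComp (Int.castRingHom ℚ)))).toNat : ℕ∞) := by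
  obtain ⟨L₀, hL₀⟩ := exists_iwasawaToPowerSeries_eq_padicLFunction_two_auto hord hf
  obtain ⟨m, hm⟩ := exists_hasOrderAtZero (lift_ne_zero_of_ratTwistedSymbolSum_ne_zero hord hf hL₀ hS0)
  have hmv := natCast_le_padicValRat_of_X_pow_dvd hord hf hL₀ hS0 hm.1
  rw [← hL₀, LambdaTransportDoorAtTwoMainConjecture.order_iota, (hasOrderAtZero_iff_order_eq L₀ m).mp hm]
  exact_mod_cast (show m ≤ (padicValRat 2 (ratTwistedSymbolSum f (ZMod.χ₈.ringHomComp (Int.castRingHom ℚ)))).toNat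
    by omega)

/-! ## §3 The rank-`≥ 2` SELMER INEQUALITY: `corank_{ℤ₂} Sel_{2^∞}(E/ℚ) ≤ v₂(S₈(f))` (Kato 18.4 at `p = 2` as the hypothesis `hK`) -/

/-- **The `2`-adic Selmer inequality from four modular symbols.** For `E/ℚ` globally minimal, good ordinary at `2`, with newform
`f`, and Kato's divisibility at `p = 2` as printed (`hK`, Astérisque 295 Thm 18.4): if
`S₈(f) = ∑_{a mod 8} χ₈(a)[a/8]⁺_f ≠ 0` then **`corank_{ℤ₂} Sel_{2^∞}(E/ℚ) ≤ v₂(S₈(f))`**. Any rank; no `μ`, no main conjecture.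
[cite: Kato2004Asterisque, Thm. 18.4 (p. 281)] [cite: MazurTateTeitelbaum1986Invent, §I.14 Proposition (p. 20)] -/
theorem selmerCorank_le_padicValRat (hK : kato_selmerCorank_le_order_padicLFunction_allPrimes W 2 (f := f))
    (hord : IsOrdinaryAt W 2) (hf : IsNewformOf W f)
    (hS0 : ratTwistedSymbolSum f (ZMod.χ₈.ringHomComp (Int.castRingHom ℚ)) ≠ 0) :
    ((W.selmerCorank 2 : ℕ) : ℤ) ≤ padicValRat 2 (ratTwistedSymbolSum f (ZMod.χ₈.ringHomComp (Int.castRingHom ℚ))) := by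
  obtain ⟨L₀, hL₀⟩ := exists_iwasawaToPowerSeries_eq_padicLFunction_two_auto hord hf
  obtain ⟨m, hm⟩ := exists_hasOrderAtZero (lift_ne_zero_of_ratTwistedSymbolSum_ne_zero hord hf hL₀ hS0)
  have hmv := natCast_le_padicValRat_of_X_pow_dvd hord hf hL₀ hS0 hm.1
  have horder : (padicLFunction f (unitRoot W 2 : ℚ_[2])).order = m := by
    rw [← hL₀, LambdaTransportDoorAtTwoMainConjecture.order_iota, (hasOrderAtZero_iff_order_eq L₀ m).mp hm]
  have hs : W.selmerCorank 2 ≤ m := by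
    have h := hK hord hf
    rw [horder] at h
    exact_mod_cast h
  omega

/-- **Rank form: `rank E(ℚ) + corank_{ℤ₂} Ш(E/ℚ)[2^∞] ≤ v₂(S₈(f))`** (the tree theorem
`corank Sel_{2^∞} = rank + corank Ш[2^∞]`, `selmerCorank_eq_mordellWeilRank_add_holds`). In particular
`rank E(ℚ) ≤ v₂(∑_{a mod 8} χ₈(a)[a/8]⁺_f)` for every `E` good ordinary at `2` with `L(E^{(2)}, 1) ≠ 0`.
[cite: Kato2004Asterisque, Thm. 18.4 (p. 281)] [cite: Greenberg1999LNM, §1 pp. 54–57] -/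
theorem mordellWeilRank_add_shaCorank_le_padicValRat
    (hK : kato_selmerCorank_le_order_padicLFunction_allPrimes W 2 (f := f))
    (hord : IsOrdinaryAt W 2) (hf : IsNewformOf W f)
    (hS0 : ratTwistedSymbolSum f (ZMod.χ₈.ringHomComp (Int.castRingHom ℚ)) ≠ 0) :
    ((W.mordellWeilRank : ℕ) : ℤ) + W.shaCorank 2 ≤
      padicValRat 2 (ratTwistedSymbolSum f (ZMod.χ₈.ringHomComp (Int.castRingHom ℚ))) := by
  have h := selmerCorank_le_padicValRat hK hord hf hS0
  have hsel := W.selmerCorank_eq_mordellWeilRank_add_holds 2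
  omega

end Value

/-! ## §4 THE DOOR: `w(E) = +1`, `corank ≥ 2`, `0 ≠ S₈(f)`, `v₂(S₈(f)) ≤ 3` ⟹ `ord_{T=0} L₂ = corank Sel_{2^∞} = 2` -/

section Door

variable {W : WeierstrassCurve ℚ} [W.IsElliptic] [W.IsGloballyMinimal] [NeZero (W.conductorNorm ℤ)]
  {f : CuspForm (Gamma0 (W.conductorNorm ℤ)) 2}

/-- **THE VALUE-AT-`−2` DOOR (Selmer form).** For `E/ℚ` globally minimal, good ordinary at `2`, `f ∈ S₂(Γ₀(N_E))` its newform,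
Kato's divisibility at `2` (`hK`), root number `w(E) = +1`, `S₈(f) ≠ 0` with `v₂(S₈(f)) ≤ 3`, and `corank_{ℤ₂} Sel_{2^∞}(E/ℚ) ≥ 2`:
**`corank_{ℤ₂} Sel_{2^∞}(E/ℚ) = 2` and `ord_{T=0} L₂(E,T) = 2`** — `2 ≤ corank ≤ ord_{T=0} ≤ v₂(S₈) ≤ 3` (§1–§3) and
`(−1)^{ord_{T=0}} = w(E) = +1` (Greenberg's sign, tree theorem `neg_one_pow_orderAtZero_eq_rootNumber`).
[cite: Kato2004Asterisque, Thm. 18.4 (p. 281)] [cite: GreenbergLNM1716, §5 p. 181]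
[cite: MazurTateTeitelbaum1986Invent, §I.14 Proposition (p. 20)] -/
theorem door (hK : kato_selmerCorank_le_order_padicLFunction_allPrimes W 2 (f := f))
    (hord : IsOrdinaryAt W 2) (hf : IsNewformOf W f) (hw : W.rootNumber = 1)
    (hS0 : ratTwistedSymbolSum f (ZMod.χ₈.ringHomComp (Int.castRingHom ℚ)) ≠ 0)
    (hS : padicValRat 2 (ratTwistedSymbolSum f (ZMod.χ₈.ringHomComp (Int.castRingHom ℚ))) ≤ 3)
    (h2 : 2 ≤ W.selmerCorank 2) :
    W.selmerCorank 2 = 2 ∧ (padicLFunction f (unitRoot W 2 : ℚ_[2])).order = 2 := by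
  obtain ⟨L₀, hL₀⟩ := exists_iwasawaToPowerSeries_eq_padicLFunction_two_auto hord hf
  have hg : iwasawaToPowerSeries 2 L₀ = C (1 : ℚ_[2]) * padicLFunction f (unitRoot W 2 : ℚ_[2]) := by
    rw [map_one, one_mul]; exact hL₀
  obtain ⟨m, hm⟩ := exists_hasOrderAtZero (lift_ne_zero_of_ratTwistedSymbolSum_ne_zero hord hf hL₀ hS0)
  have hmv := natCast_le_padicValRat_of_X_pow_dvd hord hf hL₀ hS0 hm.1
  have horder : (padicLFunction f (unitRoot W 2 : ℚ_[2])).order = m := by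
    rw [← hL₀, LambdaTransportDoorAtTwoMainConjecture.order_iota, (hasOrderAtZero_iff_order_eq L₀ m).mp hm]
  have hs : W.selmerCorank 2 ≤ m := by
    have h := hK hord hf
    rw [horder] at h
    exact_mod_cast h
  have heven : Even m := by
    have h := neg_one_pow_orderAtZero_eq_rootNumber hord hf hg hm
    rw [hw] at h
    exact (neg_one_pow_eq_one_iff_even (by norm_num)).mp h
  obtain ⟨k, hk⟩ := heven
  have hm2 : m = 2 := by omega
  subst hm2
  exact ⟨by omega, horder⟩

/-- **THE VALUE-AT-`−2` DOOR (rank form).** Same hypotheses with `rank E(ℚ) ≥ 2` (two independent points) in place of the corank: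
**`rank E(ℚ) = 2`, `corank_{ℤ₂} Ш(E/ℚ)[2^∞] = 0`, `corank_{ℤ₂} Sel_{2^∞}(E/ℚ) = 2` and `ord_{T=0} L₂(E,T) = 2 = rank E(ℚ)`** —
the `2`-adic BSD RANK statement for `E`, exactly, and the finiteness of `Ш(E/ℚ)[2^∞]`, from `w(E) = +1`, two points and
`v₂(∑_{a mod 8} χ₈(a)[a/8]⁺_f) ≤ 3`. [cite: Kato2004Asterisque, Thm. 18.4 (p. 281)] [cite: GreenbergLNM1716, §5 p. 181]
[cite: MazurTateTeitelbaum1986Invent, §I.14 Proposition (p. 20)] -/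
theorem door_rank (hK : kato_selmerCorank_le_order_padicLFunction_allPrimes W 2 (f := f))
    (hord : IsOrdinaryAt W 2) (hf : IsNewformOf W f) (hw : W.rootNumber = 1)
    (hS0 : ratTwistedSymbolSum f (ZMod.χ₈.ringHomComp (Int.castRingHom ℚ)) ≠ 0)
    (hS : padicValRat 2 (ratTwistedSymbolSum f (ZMod.χ₈.ringHomComp (Int.castRingHom ℚ))) ≤ 3)
    (h2 : 2 ≤ W.mordellWeilRank) :
    W.mordellWeilRank = 2 ∧ W.shaCorank 2 = 0 ∧ W.selmerCorank 2 = 2 ∧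
      (padicLFunction f (unitRoot W 2 : ℚ_[2])).order = 2 := by
  have hsel := W.selmerCorank_eq_mordellWeilRank_add_holds 2
  obtain ⟨hs2, ho⟩ := door hK hord hf hw hS0 hS (by omega)
  exact ⟨by omega, by omega, hs2, ho⟩

/-- **`Ш(E/ℚ)[2^∞]` is finite behind the door** (corank `0` and `Ш[2]` finite, tree theorem
`finite_primaryComponent_sha_iff_shaCorank_eq_zero`). [cite: Kato2004Asterisque, Thm. 18.4 (p. 281)] -/
theorem finite_sha_two_of_door (hK : kato_selmerCorank_le_order_padicLFunction_allPrimes W 2 (f := f))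
    (hord : IsOrdinaryAt W 2) (hf : IsNewformOf W f) (hw : W.rootNumber = 1)
    (hS0 : ratTwistedSymbolSum f (ZMod.χ₈.ringHomComp (Int.castRingHom ℚ)) ≠ 0)
    (hS : padicValRat 2 (ratTwistedSymbolSum f (ZMod.χ₈.ringHomComp (Int.castRingHom ℚ))) ≤ 3)
    (h2 : 2 ≤ W.mordellWeilRank) :
    Finite (AddCommGroup.primaryComponent W.sha 2) :=
  (finite_primaryComponent_sha_iff_shaCorank_eq_zero W 2).mpr (door_rank hK hord hf hw hS0 hS h2).2.1

/-- **What the door does NOT decide without more input (B1 honesty), as a theorem: the inequality direction only.** With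
`w(E) = +1`, `S₈(f) ≠ 0` and `corank ≥ 2` but NO bound on `v₂(S₈(f))`, one still gets `2 ≤ ord_{T=0} L₂(E,T) ≤ v₂(S₈(f))`
with `ord_{T=0}` EVEN — so `v₂(S₈(f)) ∈ {2,3}` is exactly the extra input that makes the comparison an equality.
[cite: Kato2004Asterisque, Thm. 18.4 (p. 281)] [cite: GreenbergLNM1716, §5 p. 181] -/
theorem two_le_order_and_even (hK : kato_selmerCorank_le_order_padicLFunction_allPrimes W 2 (f := f))
    (hord : IsOrdinaryAt W 2) (hf : IsNewformOf W f) (hw : W.rootNumber = 1)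
    (hS0 : ratTwistedSymbolSum f (ZMod.χ₈.ringHomComp (Int.castRingHom ℚ)) ≠ 0)
    (h2 : 2 ≤ W.selmerCorank 2) :
    ∃ m : ℕ, (padicLFunction f (unitRoot W 2 : ℚ_[2])).order = m ∧ Even m ∧ 2 ≤ m ∧
      (m : ℤ) ≤ padicValRat 2 (ratTwistedSymbolSum f (ZMod.χ₈.ringHomComp (Int.castRingHom ℚ))) := by
  obtain ⟨L₀, hL₀⟩ := exists_iwasawaToPowerSeries_eq_padicLFunction_two_auto hord hf
  have hg : iwasawaToPowerSeries 2 L₀ = C (1 : ℚ_[2]) * padicLFunction f (unitRoot W 2 : ℚ_[2]) := by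
    rw [map_one, one_mul]; exact hL₀
  obtain ⟨m, hm⟩ := exists_hasOrderAtZero (lift_ne_zero_of_ratTwistedSymbolSum_ne_zero hord hf hL₀ hS0)
  have hmv := natCast_le_padicValRat_of_X_pow_dvd hord hf hL₀ hS0 hm.1
  have horder : (padicLFunction f (unitRoot W 2 : ℚ_[2])).order = m := by
    rw [← hL₀, LambdaTransportDoorAtTwoMainConjecture.order_iota, (hasOrderAtZero_iff_order_eq L₀ m).mp hm]
  have hs : W.selmerCorank 2 ≤ m := by
    have h := hK hord hf
    rw [horder] at h
    exact_mod_cast h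
  have heven : Even m := by
    have h := neg_one_pow_orderAtZero_eq_rootNumber hord hf hg hm
    rw [hw] at h
    exact (neg_one_pow_eq_one_iff_even (by norm_num)).mp h
  exact ⟨m, horder, heven, le_trans h2 hs, hmv⟩

end Door

end Summit.BirchSwinnertonDyer.BirchSwinnertonDyer.Theorems.LambdaTransportDoorAtTwoValueAtMinusTwo

end
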